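import Summits.Ventures.PercRepro.S2FlatTailBounds

/-!
# PercRepro — THE BINOMIAL TAIL FROM A NUMERICAL BASE, AND THE TWO BASES THE LEVEL-7 CHAIN NEEDS (p4, gen 15; a feeder for S4)

`sixteen_mul_sum_range_choose_le_of_base`: once `16·Σ_{j ≤ K} C(n₀, j) ≤ 2^n₀`, the same holds for every `n ≥ n₀`
(p7's `sum_choose_succ_le_two_mul`: `Σ_{j ≤ K} C(n + 1, j) ≤ 2·Σ_{j ≤ K} C(n, j)`). The bases `(K, n₀) = (94, 241)` and `(95, 242)` are the two
coranks of the level-`7` partition chain where the `5/2` tail (`5K + 14 ≤ 2n`) would hold the chain at `p ≥ 148 / 150`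
instead of the certificate's `147`: with them the chain's threshold is `147`. Axioms: standard.
-/

set_option exponentiation.threshold 1024

namespace PercRepro

namespace ThmN.Explicit

/-- **The tail from a base**: if `16·Σ_{j ≤ K} C(n₀, j) ≤ 2^n₀` then `16·Σ_{j ≤ K} C(n, j) ≤ 2^n` for every `n ≥ n₀`. -/
theorem sixteen_mul_sum_range_choose_le_of_base (K n₀ : ℕ)
    (h : 16 * ∑ j ∈ Finset.range (K + 1), n₀.choose j ≤ 2 ^ n₀) (n : ℕ) (hn : n₀ ≤ n) :
    16 * ∑ j ∈ Finset.range (K + 1), n.choose j ≤ 2 ^ n := by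
  induction n, hn using Nat.le_induction with
  | base => exact h
  | succ n _ ih =>
    have h1 := PercRepro.sum_choose_succ_le_two_mul n K
    calc 16 * ∑ j ∈ Finset.range (K + 1), (n + 1).choose j
        ≤ 16 * (2 * ∑ j ∈ Finset.range (K + 1), n.choose j) := Nat.mul_le_mul_left _ h1
      _ = 2 * (16 * ∑ j ∈ Finset.range (K + 1), n.choose j) := by ring
      _ ≤ 2 * 2 ^ n := Nat.mul_le_mul_left _ ih
      _ = 2 ^ (n + 1) := by ring

/-- The base `(K, n₀) = (94, 241)`: `16·Σ_{j ≤ 94} C(241, j) ≤ 2^241`. -/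
theorem sixteen_mul_sum_range_choose_base_94 : 16 * ∑ j ∈ Finset.range (94 + 1), (241).choose j ≤ 2 ^ 241 := by
  simp only [Finset.sum_range_succ, Finset.sum_range_zero, Nat.choose_eq_descFactorial_div_factorial]
  norm_num

/-- The base `(K, n₀) = (95, 242)`: `16·Σ_{j ≤ 95} C(242, j) ≤ 2^242`. -/
theorem sixteen_mul_sum_range_choose_base_95 : 16 * ∑ j ∈ Finset.range (95 + 1), (242).choose j ≤ 2 ^ 242 := by
  simp only [Finset.sum_range_succ, Finset.sum_range_zero, Nat.choose_eq_descFactorial_div_factorial]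
  norm_num

/-- `16·Σ_{j ≤ 94} C(n, j) ≤ 2^n` for every `n ≥ 241`. -/
theorem sixteen_mul_sum_range_choose_le_ninetyfour (n : ℕ) (hn : 241 ≤ n) :
    16 * ∑ j ∈ Finset.range (94 + 1), n.choose j ≤ 2 ^ n :=
  sixteen_mul_sum_range_choose_le_of_base 94 241 sixteen_mul_sum_range_choose_base_94 n hn

/-- `16·Σ_{j ≤ 95} C(n, j) ≤ 2^n` for every `n ≥ 242`. -/
theorem sixteen_mul_sum_range_choose_le_ninetyfive (n : ℕ) (hn : 242 ≤ n) :
    16 * ∑ j ∈ Finset.range (95 + 1), n.choose j ≤ 2 ^ n :=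
  sixteen_mul_sum_range_choose_le_of_base 95 242 sixteen_mul_sum_range_choose_base_95 n hn

end ThmN.Explicit

end PercRepro
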